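/-
Copyright (c) 2026 the pub-hodgecm-mathlib formalisation cell (harness21).  Prover seat hodgecm-mathlib-K2E4-p23 (g2), Track B ∕ K2-LIT, h413 =
`stmt-HodgeConjecture-24833`, ENGINE E1, 5Res campaign «BL-2(χ,τ) ∘ MS-2(χ,τ) ∘ ARCH-UNITARITY ∘ R8₂» (this seat's census (45c), K2 bus 2026-09-04T10:16:55Z), deal (80)
«(d) ARCH-UNITARITY FILE 2 + FILE 3, Hecke∕unitarity road of record» of the dealer K2E1-plan (g6) 2026-09-04T10:34:42Z: the DEFS LEAF (F2a) of FILE 2.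
-/
import Mathlib.Analysis.SpecialFunctions.Pow.Complex
import Mathlib.Analysis.SpecialFunctions.Complex.Circle
import Mathlib.MeasureTheory.Integral.IntervalIntegral.Periodic
import HarnessLib

/-!
# K2·E1 — `K2E1ArchTorusCoefficientU11Defs`: THE DIAGONAL MATRIX COEFFICIENT `Φ_{s,m}(a)` OF THE PRINCIPAL SERIES OF `U(1,1)(ℝ)` ALONG THE SPLIT TORUS
# (the function whose reality on `a > 0` is forced by unitarity and whose second-order expansion at `a = 1` is the Casimir scalar `s² − s − m²∕4`)

Track B ∕ K2-LIT, crux h413 = `stmt-HodgeConjecture-24833`, route of record `HCCMUnconditional`; cell `hodgecm-mathlib`, squad K2, ENGINE E1 (socket module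
`K2_E1_TraceFormulaBetaSigs_GlobalIndex` ED. 12, live socket 5Res :247 read «⟸ (H4-b) exponent finiteness per `K`-type» by ★ p857196).  Prover seat `hodgecm-mathlib-K2E4-p23` (g2);
deal (80) of the dealer K2E1-plan (g6).  DEFINITIONS WITH BODIES + their trivial API (no `instance`, no notation, no named-fact hypothesis, no `sorry`); lane
`--kind definition --supports stmt-HodgeConjecture-24833 --as helper` (reviewed).  CLOSES NO SOCKET.

THE MATHEMATICS (ARCH-UNITARITY, the pole COUNT of the residual spectrum per `K`-type; [Knapp1986, VII §1; Bump1997, §2.6; BorelWallach2000, 0 §2.5]).  At a real place `v` of `L⁺`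
the group is `U(1,1)(ℝ)` with `K_v ≅ U(1) × U(1)` (elements `(a′ b′; b′ a′)`, `|a′ ± b′| = 1`, ★ `K2E1ArchComponentKTypeU2`), split torus `t(a) = diag(a, a⁻¹)`, `a > 0`.  For the
principal series datum `(χ_v, z)` with `χ_v = |·|_ℂ^{it}(·∕|·|)^k` and the `K_v`-type `κ = (p, q)`, `p + q = k`, put `s := z + it`, `m := p − q`.  The last row of `k′·t(a)` is `(b′a, a′a⁻¹)`,
so with `u = a′ + b′`, `v′ = a′ − b′`, `ζ = v′∕u`:  `r₀ + r₁ = u·W_a(ζ)∕2`, `r₁ − r₀ = v′·\overline{W_a(ζ)}∕(2ζ)`-type, `‖r‖² = |W_a(ζ)|²∕4`, where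
**`W_a(ζ) := (a + a⁻¹) − ζ·(a − a⁻¹)`**; hence the `κ`–`κ` matrix coefficient of `I(χ_v, z)` at `t(a)` — the integral over `K_v∕Z` of `conj κ` against the translated flat section of
height exponent `s` and angular weights `(p, q)` — is
**`Φ_{s,m}(a) = (2π)⁻¹ ∫_0^{2π} (|W_a(e^{iθ})|²∕4)^{−s} · (W_a(e^{iθ})∕|W_a(e^{iθ})|)^m dθ`**  (`m = 0`: the zonal spherical function of `SL₂(ℝ) ≅ SU(1,1)` in the `a²sin² + a⁻²cos²` form).
USE (FILE 3, hypothesis-first): for an `L²` residual vector `ψ ≠ 0` of this arch datum, unitarity of right translation gives `⟪R(t(a))ψ, ψ⟫ = Φ_{s,m}(a)‖ψ‖²` HERMITIAN in `a ↦ a⁻¹`, while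
`Φ_{s,m}(a⁻¹) = Φ_{s,m}(a)` (Weyl symmetry `θ ↦ θ + π`), so `Φ_{s,m}` is REAL on `a > 0`; FILE 2 (F2b) shows `Φ_{s,m}(e^u) = 1 + (s² − s − m²∕4)u² + O(u³)`, whence `Im(s² − s) =
(2 Re s − 1)·Im s = 0`: **`t = 0` or `z = ½`** — no pole of `E(χ, ·)` on `(½, 1]` survives unless `χ_∞` is trivial on `(L_∞ˣ)⁰` (after the split-component normalisation).
WHAT IS HERE: §1 `torusW a θ` and its algebra (`re_torusW`, positivity of the real part and of the norm for `a > 0`, `torusW_one`, `torusW_inv` : `W_{a⁻¹}(θ) = W_a(θ + π)`,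
`normSq` formula, `2π`-periodicity); §2 **`archTorusCoeff s m a`** (`= Φ_{s,m}(a)`) with `archTorusCoeff_one : Φ_{s,m}(1) = 1` and the WEYL SYMMETRY **`archTorusCoeff_inv : Φ_{s,m}(a⁻¹) =
Φ_{s,m}(a)`**.  NOT here (F2b ∕ F3): the second-order expansion, the reality argument, anything adelic.
HONEST LABEL: HC_CM is proved only modulo the 7 printed citations (2 remaining named inputs: hLiu418 = `stmt-HodgeConjecture-24832`, h413 = `stmt-HodgeConjecture-24833`) until rung 0
closes; this file defines two functions, asserts no named fact and closes no socket; count-neutral.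

## References
* [Knapp1986] A. W. Knapp, *Representation Theory of Semisimple Groups* (1986), VII §1 (matrix coefficients, spherical functions of `SL₂(ℝ)`).
* [Bump1997] D. Bump, *Automorphic Forms and Representations* (1997), §2.6 Thm. 2.6.3 (unitarity forces a real Casimir parameter).
* [BorelWallach2000] A. Borel, N. Wallach, *Continuous Cohomology, Discrete Subgroups, and Representations of Reductive Groups*, 2nd ed. (2000), 0 §2.5.
* [MoeglinWaldspurger1995] C. Mœglin, J.-L. Waldspurger, *Spectral Decomposition and Eisenstein Series* (1995), IV.3 (poles on the positive real segment), V.3.13.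
-/

set_option autoImplicit false
-- the mandated namespace repeats the single-problem summit's segment (`HodgeConjecture.HodgeConjecture`)
set_option linter.dupNamespace false

noncomputable section

open Real Complex MeasureTheory intervalIntegral

namespace Summit.HodgeConjecture.HodgeConjecture.Cruxes.H413.K2E1ArchTorusCoefficientU11Defs

/-! ## §1 The last-row quantity `W_a(θ) = (a + a⁻¹) − e^{iθ}(a − a⁻¹)` -/

/-- **`W_a(θ) := (a + a⁻¹) − e^{iθ}·(a − a⁻¹)`** — for `k′ = (a′ b′; b′ a′) ∈ K_v` with `e^{iθ} = (a′ − b′)∕(a′ + b′)` and the torus element `t(a) = diag(a, a⁻¹)` of `U(1,1)(ℝ)`,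
the sum of the last-row entries of `k′·t(a)` is `(a′+b′)·W_a(θ)∕2`, and `‖last row‖² = |W_a(θ)|²∕4` (so the local height is `4∕|W_a(θ)|²`).
[cite: Knapp1986, VII §1] -/
def torusW (a θ : ℝ) : ℂ :=
  ((a + a⁻¹ : ℝ) : ℂ) - Complex.exp (θ * Complex.I) * ((a - a⁻¹ : ℝ) : ℂ)

/-- Unfolding of `torusW`. [folklore] -/
theorem torusW_def (a θ : ℝ) : torusW a θ = ((a + a⁻¹ : ℝ) : ℂ) - Complex.exp (θ * Complex.I) * ((a - a⁻¹ : ℝ) : ℂ) := rfl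

/-- The real part of `W_a(θ)` is `(a + a⁻¹) − cos θ·(a − a⁻¹)`. [folklore] -/
theorem re_torusW (a θ : ℝ) : (torusW a θ).re = (a + a⁻¹) - Real.cos θ * (a - a⁻¹) := by
  simp [torusW, Complex.sub_re, Complex.mul_re, Complex.exp_ofReal_mul_I_re, Complex.exp_ofReal_mul_I_im,
    Complex.ofReal_re, Complex.ofReal_im]

/-- The imaginary part of `W_a(θ)` is `−sin θ·(a − a⁻¹)`. [folklore] -/
theorem im_torusW (a θ : ℝ) : (torusW a θ).im = -(Real.sin θ * (a - a⁻¹)) := by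
  simp [torusW, Complex.sub_im, Complex.mul_im, Complex.exp_ofReal_mul_I_re, Complex.exp_ofReal_mul_I_im,
    Complex.ofReal_re, Complex.ofReal_im]

/-- For `a > 0` the real part of `W_a(θ)` is at least `2·min(a, a⁻¹) > 0`: precisely `2 a⁻¹ ≤ Re W` if `1 ≤ a`... in general `Re W_a(θ) ≥ (a + a⁻¹) − |a − a⁻¹| > 0`. [folklore] -/
theorem re_torusW_pos {a : ℝ} (ha : 0 < a) (θ : ℝ) : 0 < (torusW a θ).re := by
  rw [re_torusW]
  have hcos : |Real.cos θ * (a - a⁻¹)| ≤ |a - a⁻¹| := by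
    rw [abs_mul]
    exact mul_le_of_le_one_left (abs_nonneg _) (Real.abs_cos_le_one θ)
  have hai : 0 < a⁻¹ := inv_pos.2 ha
  have hlt : |a - a⁻¹| < a + a⁻¹ := abs_sub_lt_iff.2 ⟨by linarith, by linarith⟩
  have := neg_abs_le (Real.cos θ * (a - a⁻¹))
  linarith [(abs_le.1 hcos).2, le_abs_self (Real.cos θ * (a - a⁻¹))]

/-- `W_a(θ) ≠ 0` for `a > 0`. [folklore] -/
theorem torusW_ne_zero {a : ℝ} (ha : 0 < a) (θ : ℝ) : torusW a θ ≠ 0 := fun h => by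
  have := re_torusW_pos ha θ
  rw [h, Complex.zero_re] at this
  exact lt_irrefl 0 this

/-- `0 < ‖W_a(θ)‖` for `a > 0`. [folklore] -/
theorem norm_torusW_pos {a : ℝ} (ha : 0 < a) (θ : ℝ) : 0 < ‖torusW a θ‖ :=
  norm_pos_iff.2 (torusW_ne_zero ha θ)

/-- `|W_a(θ)|² = 2(a² + a⁻²) − 2(a² − a⁻²)·cos θ` (`= 4(a² sin²(θ∕2) + a⁻² cos²(θ∕2))`, the `SL₂(ℝ)` height denominator). [cite: Knapp1986, VII §1] -/
theorem normSq_torusW (a θ : ℝ) :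
    Complex.normSq (torusW a θ) = 2 * (a ^ 2 + a⁻¹ ^ 2) - 2 * (a ^ 2 - a⁻¹ ^ 2) * Real.cos θ := by
  rw [Complex.normSq_apply, re_torusW, im_torusW]
  have h := Real.sin_sq_add_cos_sq θ
  have key : ((a + a⁻¹) - Real.cos θ * (a - a⁻¹)) * ((a + a⁻¹) - Real.cos θ * (a - a⁻¹)) +
      (-(Real.sin θ * (a - a⁻¹))) * (-(Real.sin θ * (a - a⁻¹))) =
      (a + a⁻¹) ^ 2 + (a - a⁻¹) ^ 2 * (Real.sin θ ^ 2 + Real.cos θ ^ 2) - 2 * ((a + a⁻¹) * (a - a⁻¹)) * Real.cos θ := by ring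
  rw [key, h]
  ring

/-- At the identity of the torus, `W_1(θ) = 2`. [folklore] -/
theorem torusW_one (θ : ℝ) : torusW 1 θ = 2 := by
  simp [torusW]; norm_num

/-- **Weyl symmetry on the integrand**: `W_{a⁻¹}(θ) = W_a(θ + π)` (`a⁻¹ + a = a + a⁻¹`, `a⁻¹ − a = −(a − a⁻¹)`, `e^{i(θ+π)} = −e^{iθ}`; in Lean also at `a = 0`). [folklore] -/
theorem torusW_inv (a θ : ℝ) : torusW a⁻¹ θ = torusW a (θ + π) := by
  have h : Complex.exp (((θ + π : ℝ) : ℂ) * Complex.I) = -Complex.exp ((θ : ℂ) * Complex.I) := by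
    rw [Complex.ofReal_add, add_mul, Complex.exp_add, Complex.exp_pi_mul_I]
    ring
  rw [torusW, torusW, h, inv_inv]
  push_cast
  ring

/-- `θ ↦ W_a(θ)` is `2π`-periodic. [folklore] -/
theorem periodic_torusW (a : ℝ) : Function.Periodic (torusW a) (2 * π) := fun θ => by
  simp only [torusW]
  have h : Complex.exp (((θ + 2 * π : ℝ) : ℂ) * Complex.I) = Complex.exp ((θ : ℂ) * Complex.I) := by
    rw [Complex.ofReal_add, add_mul, Complex.exp_add]
    have : Complex.exp (((2 * π : ℝ) : ℂ) * Complex.I) = 1 := by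
      rw [show (((2 * π : ℝ) : ℂ) * Complex.I) = 2 * π * Complex.I by push_cast; ring]
      exact Complex.exp_two_pi_mul_I
    rw [this, mul_one]
  rw [h]

/-- `θ ↦ W_a(θ)` is continuous. [folklore] -/
theorem continuous_torusW (a : ℝ) : Continuous (torusW a) := by
  unfold torusW
  fun_prop

/-! ## §2 The diagonal matrix coefficient `Φ_{s,m}(a)` -/

/-- The integrand of `Φ_{s,m}(a)`: `(|W_a(θ)|²∕4)^{−s} · (W_a(θ)∕|W_a(θ)|)^m` — height exponent `s` (a complex power of the POSITIVE real `|W|²∕4`, no branch issue) times the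
unit angular phase raised to the integer `m = p − q`. [cite: Knapp1986, VII §1] -/
def archTorusIntegrand (s : ℂ) (m : ℤ) (a θ : ℝ) : ℂ :=
  (((Complex.normSq (torusW a θ) / 4 : ℝ) : ℂ) ^ (-s)) * ((torusW a θ / (‖torusW a θ‖ : ℂ)) ^ m)

/-- **`Φ_{s,m}(a) := (2π)⁻¹ ∫_0^{2π} (|W_a(θ)|²∕4)^{−s} (W_a(θ)∕|W_a(θ)|)^m dθ`** — the `κ`–`κ` diagonal matrix coefficient at `t(a) = diag(a, a⁻¹)` of the principal series
`I(χ_v, z)` of `U(1,1)(ℝ)` with `s = z + it`, `κ = (p, q)`, `m = p − q` (for `m = 0` the zonal spherical function).  [cite: Knapp1986, VII §1] [cite: Bump1997, §2.6] -/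
def archTorusCoeff (s : ℂ) (m : ℤ) (a : ℝ) : ℂ :=
  ((2 * π)⁻¹ : ℝ) • ∫ θ in (0 : ℝ)..2 * π, archTorusIntegrand s m a θ

/-- Unfolding of `archTorusCoeff`. [folklore] -/
theorem archTorusCoeff_def (s : ℂ) (m : ℤ) (a : ℝ) :
    archTorusCoeff s m a = ((2 * π)⁻¹ : ℝ) • ∫ θ in (0 : ℝ)..2 * π, archTorusIntegrand s m a θ := rfl

/-- The integrand is `2π`-periodic in `θ`. [folklore] -/
theorem periodic_archTorusIntegrand (s : ℂ) (m : ℤ) (a : ℝ) : Function.Periodic (archTorusIntegrand s m a) (2 * π) := fun θ => by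
  simp only [archTorusIntegrand, periodic_torusW a θ]

/-- At the identity the integrand is `1`. [folklore] -/
theorem archTorusIntegrand_one (s : ℂ) (m : ℤ) (θ : ℝ) : archTorusIntegrand s m 1 θ = 1 := by
  have h2 : ((2 : ℂ) / ((‖(2 : ℂ)‖ : ℝ) : ℂ)) = 1 := by
    rw [Complex.norm_two]; norm_num
  simp only [archTorusIntegrand, torusW_one, Complex.normSq_apply, Complex.re_ofNat, Complex.im_ofNat, mul_zero, add_zero]
  rw [show ((2 : ℝ) * 2 / 4 : ℝ) = 1 by norm_num, Complex.ofReal_one, Complex.one_cpow, h2, one_zpow, mul_one]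

/-- **`Φ_{s,m}(1) = 1`** (the matrix coefficient of a unit vector at the identity). [folklore] -/
theorem archTorusCoeff_one (s : ℂ) (m : ℤ) : archTorusCoeff s m 1 = 1 := by
  rw [archTorusCoeff_def]
  have hI : (∫ θ in (0 : ℝ)..2 * π, archTorusIntegrand s m 1 θ) = ((2 * π : ℝ) : ℂ) := by
    simp_rw [archTorusIntegrand_one]
    rw [intervalIntegral.integral_const, sub_zero, Complex.real_smul, mul_one]
  rw [hI, Complex.real_smul]
  have hπ : ((π : ℝ) : ℂ) ≠ 0 := Complex.ofReal_ne_zero.2 Real.pi_pos.ne'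
  push_cast
  field_simp

/-- The integrand at `a⁻¹` is the integrand at `a` shifted by `π`. [folklore] -/
theorem archTorusIntegrand_inv (s : ℂ) (m : ℤ) (a θ : ℝ) :
    archTorusIntegrand s m a⁻¹ θ = archTorusIntegrand s m a (θ + π) := by
  simp only [archTorusIntegrand, torusW_inv a θ]

/-- **WEYL SYMMETRY `Φ_{s,m}(a⁻¹) = Φ_{s,m}(a)`** (`a ≠ 0`): `t(a⁻¹) = w·t(a)·w⁻¹` with `w ∈ K_v`; on the integral, the shift `θ ↦ θ + π` of a `2π`-periodic integrand over a full
period. [cite: Knapp1986, VII §1] -/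
theorem archTorusCoeff_inv (s : ℂ) (m : ℤ) (a : ℝ) : archTorusCoeff s m a⁻¹ = archTorusCoeff s m a := by
  rw [archTorusCoeff_def, archTorusCoeff_def]
  congr 1
  simp_rw [archTorusIntegrand_inv s m a]
  have hper := periodic_archTorusIntegrand s m a
  rw [intervalIntegral.integral_comp_add_right (fun θ => archTorusIntegrand s m a θ) π, zero_add,
    show 2 * π + π = π + 2 * π by ring, hper.intervalIntegral_add_eq π 0, zero_add]

/-! ## §3 (ED. 2) The exponential–logarithmic form on the torus `a = e^u` (the form FILE 2 differentiates)

With `a = e^u`: `a + a⁻¹ = 2 cosh u`, `a − a⁻¹ = 2 sinh u`, so `W_{e^u}(θ) = 2·P_u(θ)` with `P_u(θ) := cosh u − e^{iθ} sinh u`, `|P_u(θ)|² = q_u(θ) := cosh 2u − cos θ·sinh 2u`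
(`≥ e^{−2|u|} > 0`), and the integrand becomes `q^{−s}·(P∕|P|)^m = exp((−s − m∕2)·log q)·P^m` — a product of an exponential of a real logarithm and an integer power, whose
`u`-derivatives are the logarithmic ones (`E_u = E·A`, `A = (−s − m∕2) q_u∕q + m P_u∕P`; FILE 2 = `K2E1ArchTorusCoefficientDerivativesU11` ∕ `…ExpansionU11`). -/

/-- `P_u(θ) := cosh u − e^{iθ}·sinh u` (so that `W_{e^u}(θ) = 2·P_u(θ)`). [cite: Knapp1986, VII §1] -/
def torusP (u θ : ℝ) : ℂ :=
  ((Real.cosh u : ℝ) : ℂ) - Complex.exp (θ * Complex.I) * ((Real.sinh u : ℝ) : ℂ)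

/-- `q_u(θ) := cosh 2u − cos θ·sinh 2u` (`= |P_u(θ)|²`). [cite: Knapp1986, VII §1] -/
def torusQ (u θ : ℝ) : ℝ :=
  Real.cosh (2 * u) - Real.cos θ * Real.sinh (2 * u)

/-- Unfolding of `torusP`. [folklore] -/
theorem torusP_def (u θ : ℝ) : torusP u θ = ((Real.cosh u : ℝ) : ℂ) - Complex.exp (θ * Complex.I) * ((Real.sinh u : ℝ) : ℂ) := rfl

/-- Unfolding of `torusQ`. [folklore] -/
theorem torusQ_def (u θ : ℝ) : torusQ u θ = Real.cosh (2 * u) - Real.cos θ * Real.sinh (2 * u) := rfl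

/-- `Re P_u(θ) = cosh u − cos θ·sinh u`. [folklore] -/
theorem re_torusP (u θ : ℝ) : (torusP u θ).re = Real.cosh u - Real.cos θ * Real.sinh u := by
  simp [torusP, Complex.sub_re, Complex.mul_re, Complex.exp_ofReal_mul_I_re, Complex.exp_ofReal_mul_I_im,
    Complex.cosh_ofReal_re, Complex.sinh_ofReal_re, Complex.sinh_ofReal_im]

/-- `Im P_u(θ) = −sin θ·sinh u`. [folklore] -/
theorem im_torusP (u θ : ℝ) : (torusP u θ).im = -(Real.sin θ * Real.sinh u) := by
  simp [torusP, Complex.sub_im, Complex.mul_im, Complex.exp_ofReal_mul_I_re, Complex.exp_ofReal_mul_I_im,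
    Complex.cosh_ofReal_im, Complex.sinh_ofReal_re, Complex.sinh_ofReal_im]

/-- **`|P_u(θ)|² = q_u(θ)`** (`cosh² + sinh² = cosh 2u`, `2 sinh cosh = sinh 2u`). [cite: Knapp1986, VII §1] -/
theorem normSq_torusP (u θ : ℝ) : Complex.normSq (torusP u θ) = torusQ u θ := by
  rw [Complex.normSq_apply, re_torusP, im_torusP, torusQ, Real.cosh_two_mul, Real.sinh_two_mul]
  have h := Real.sin_sq_add_cos_sq θ
  have key : (Real.cosh u - Real.cos θ * Real.sinh u) * (Real.cosh u - Real.cos θ * Real.sinh u) +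
      (-(Real.sin θ * Real.sinh u)) * (-(Real.sin θ * Real.sinh u)) =
      Real.cosh u ^ 2 + Real.sinh u ^ 2 * (Real.sin θ ^ 2 + Real.cos θ ^ 2) - Real.cos θ * (2 * Real.sinh u * Real.cosh u) := by ring
  rw [key, h]
  ring

/-- **`q_u(θ) > 0`**: `q ≥ cosh 2u − |sinh 2u| = e^{−|2u|} > 0`. [folklore] -/
theorem torusQ_pos (u θ : ℝ) : 0 < torusQ u θ := by
  rw [torusQ]
  have h1 : Real.cos θ * Real.sinh (2 * u) ≤ |Real.sinh (2 * u)| := by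
    calc Real.cos θ * Real.sinh (2 * u) ≤ |Real.cos θ * Real.sinh (2 * u)| := le_abs_self _
      _ = |Real.cos θ| * |Real.sinh (2 * u)| := abs_mul _ _
      _ ≤ 1 * |Real.sinh (2 * u)| := mul_le_mul_of_nonneg_right (Real.abs_cos_le_one θ) (abs_nonneg _)
      _ = |Real.sinh (2 * u)| := one_mul _
  have h2 : |Real.sinh (2 * u)| < Real.cosh (2 * u) := by
    rcases le_or_gt 0 (Real.sinh (2 * u)) with h | h
    · rw [abs_of_nonneg h]; exact Real.sinh_lt_cosh (2 * u)
    · rw [abs_of_neg h]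
      have := Real.cosh_add_sinh (2 * u)
      linarith [Real.exp_pos (2 * u)]
  linarith

/-- `P_u(θ) ≠ 0`. [folklore] -/
theorem torusP_ne_zero (u θ : ℝ) : torusP u θ ≠ 0 := fun h => by
  have := normSq_torusP u θ
  rw [h, map_zero] at this
  exact (torusQ_pos u θ).ne this

/-- `‖P_u(θ)‖ = √q_u(θ)`. [folklore] -/
theorem norm_torusP (u θ : ℝ) : ‖torusP u θ‖ = Real.sqrt (torusQ u θ) := by
  rw [← normSq_torusP, Complex.norm_def]

/-- **`W_{e^u}(θ) = 2·P_u(θ)`** (`e^u + e^{−u} = 2 cosh u`, `e^u − e^{−u} = 2 sinh u`). [folklore] -/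
theorem torusW_exp (u θ : ℝ) : torusW (Real.exp u) θ = 2 * torusP u θ := by
  rw [torusW, torusP, ← Real.exp_neg, Real.cosh_eq, Real.sinh_eq]
  push_cast
  ring

/-- `|W_{e^u}(θ)|²∕4 = q_u(θ)`. [folklore] -/
theorem normSq_torusW_exp_div_four (u θ : ℝ) : Complex.normSq (torusW (Real.exp u) θ) / 4 = torusQ u θ := by
  rw [torusW_exp, map_mul, ← normSq_torusP]
  have : Complex.normSq (2 : ℂ) = 4 := by norm_num [Complex.normSq_apply]
  rw [this]
  ring

/-- The exponential–logarithmic integrand `E_{s,m}(u, θ) := exp((−s − m∕2)·log q_u(θ))·P_u(θ)^m`. [cite: Knapp1986, VII §1] -/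
def archTorusExpIntegrand (s : ℂ) (m : ℤ) (u θ : ℝ) : ℂ :=
  Complex.exp ((-s - (m : ℂ) / 2) * ((Real.log (torusQ u θ) : ℝ) : ℂ)) * torusP u θ ^ m

/-- Unfolding of `archTorusExpIntegrand`. [folklore] -/
theorem archTorusExpIntegrand_def (s : ℂ) (m : ℤ) (u θ : ℝ) :
    archTorusExpIntegrand s m u θ = Complex.exp ((-s - (m : ℂ) / 2) * ((Real.log (torusQ u θ) : ℝ) : ℂ)) * torusP u θ ^ m := rfl

/-- `√q = e^{(log q)∕2}` for `q > 0`. [folklore] -/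
theorem sqrt_eq_exp_log_div_two {q : ℝ} (hq : 0 < q) : Real.sqrt q = Real.exp (Real.log q / 2) := by
  rw [Real.sqrt_eq_iff_mul_self_eq_of_pos (Real.exp_pos _), ← Real.exp_add, add_halves, Real.exp_log hq]

/-- **The two integrands agree on the torus `a = e^u`**: `(|W|²∕4)^{−s}·(W∕|W|)^m = exp((−s − m∕2) log q)·P^m` at `a = e^u`
(`q^{−s} = e^{−s log q}`, `W∕|W| = P∕|P|`, `|P|^{−m} = e^{−(m∕2) log q}`). [cite: Knapp1986, VII §1] -/
theorem archTorusIntegrand_exp (s : ℂ) (m : ℤ) (u θ : ℝ) :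
    archTorusIntegrand s m (Real.exp u) θ = archTorusExpIntegrand s m u θ := by
  have hq : 0 < torusQ u θ := torusQ_pos u θ
  have hP : torusP u θ ≠ 0 := torusP_ne_zero u θ
  have hqC : ((torusQ u θ : ℝ) : ℂ) ≠ 0 := Complex.ofReal_ne_zero.2 hq.ne'
  rw [archTorusIntegrand, normSq_torusW_exp_div_four, archTorusExpIntegrand_def]
  -- the height factor: `q^{−s} = exp(−s·log q)`
  have h1 : (((torusQ u θ : ℝ) : ℂ)) ^ (-s) = Complex.exp (-s * ((Real.log (torusQ u θ) : ℝ) : ℂ)) := by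
    rw [Complex.cpow_def_of_ne_zero hqC, Complex.ofReal_log hq.le, mul_comm]
  -- the phase factor: `W∕‖W‖ = P∕‖P‖` and `‖P‖ = e^{(log q)∕2}`
  have h2 : torusW (Real.exp u) θ / ((‖torusW (Real.exp u) θ‖ : ℝ) : ℂ) = torusP u θ / ((‖torusP u θ‖ : ℝ) : ℂ) := by
    rw [torusW_exp, norm_mul, Complex.norm_two, Complex.ofReal_mul, Complex.ofReal_ofNat]
    have h2' : ((‖torusP u θ‖ : ℝ) : ℂ) ≠ 0 := Complex.ofReal_ne_zero.2 (norm_ne_zero_iff.2 hP)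
    field_simp
  have h3 : ((‖torusP u θ‖ : ℝ) : ℂ) = Complex.exp (((Real.log (torusQ u θ) : ℝ) : ℂ) / 2) := by
    rw [norm_torusP, sqrt_eq_exp_log_div_two hq, Complex.ofReal_exp]
    push_cast
    ring_nf
  rw [h1, h2, h3, div_eq_mul_inv, mul_zpow, ← Complex.exp_neg, ← Complex.exp_int_mul, mul_comm (torusP u θ ^ m),
    ← mul_assoc, ← Complex.exp_add]
  congr 1
  congr 1
  ring

/-- **`Φ_{s,m}(e^u)` as the integral of the exponential–logarithmic integrand.** [cite: Knapp1986, VII §1] -/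
theorem archTorusCoeff_exp (s : ℂ) (m : ℤ) (u : ℝ) :
    archTorusCoeff s m (Real.exp u) = ((2 * π)⁻¹ : ℝ) • ∫ θ in (0 : ℝ)..2 * π, archTorusExpIntegrand s m u θ := by
  rw [archTorusCoeff_def]
  simp_rw [archTorusIntegrand_exp]

/-- At `u = 0`: `P_0(θ) = 1`. [folklore] -/
theorem torusP_zero (θ : ℝ) : torusP 0 θ = 1 := by simp [torusP]

/-- At `u = 0`: `q_0(θ) = 1`. [folklore] -/
theorem torusQ_zero (θ : ℝ) : torusQ 0 θ = 1 := by simp [torusQ]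

/-- At `u = 0` the exponential–logarithmic integrand is `1`. [folklore] -/
theorem archTorusExpIntegrand_zero (s : ℂ) (m : ℤ) (θ : ℝ) : archTorusExpIntegrand s m 0 θ = 1 := by
  simp [archTorusExpIntegrand, torusP_zero, torusQ_zero]

/-- `θ ↦ P_u(θ)` is continuous. [folklore] -/
theorem continuous_torusP (u : ℝ) : Continuous (torusP u) := by
  unfold torusP; fun_prop

/-- `θ ↦ q_u(θ)` is continuous. [folklore] -/
theorem continuous_torusQ (u : ℝ) : Continuous (torusQ u) := by
  unfold torusQ; fun_prop

/-- `(u, θ) ↦ P_u(θ)` is jointly continuous. [folklore] -/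
theorem continuous_torusP₂ : Continuous fun p : ℝ × ℝ => torusP p.1 p.2 := by
  unfold torusP; fun_prop

/-- `(u, θ) ↦ q_u(θ)` is jointly continuous. [folklore] -/
theorem continuous_torusQ₂ : Continuous fun p : ℝ × ℝ => torusQ p.1 p.2 := by
  unfold torusQ; fun_prop

end Summit.HodgeConjecture.HodgeConjecture.Cruxes.H413.K2E1ArchTorusCoefficientU11Defs

end
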